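import Summits.QuantumFields.YangMills.Theorems.BalabanLadderROTWardShapeProfile
import HarnessLib

/-!
# Crux `ROT` (stmt-QuantumFields-20042), infinitesimal Ward route (lane B) — VI: the shape witness, part 2 (rotational derivative, limit integrand, shape predicates)

Helper file (`--supports stmt-QuantumFields-20042`, lane `ym-rot-20042-p2`).

* §1 **the rotational derivative of the test function**: `dF_s(w)·Y(w) = ψ(w₁) χ_s(w₀−w₁) h(w₀−w₁)` (`fderiv_FTest_rotField`;
  product and chain rules, the radial factors contribute nothing);
* §2 **the limit integrand** `Φ_s(w) = h(z) ψ(w₁) χ_s(z) h(z)`, `z = w₀ − w₁`: continuous, compactly supported, `≥ 0`, positive at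
  `(s e₁, 0)`, hence `∫ Φ_s > 0` (`integral_PhiFun_pos`);
* §3 **the shape predicates** — the TEXTS of the hyperscaling binder `MomentBounds G r a` and of the Ward form
  `LatticeAngularWard G r a` of the crux's conclusion with the centred torus moment function of `tr F²` replaced by an ABSTRACT weight
  family `W β L n x` (`MomentBoundsShape a W`, `AngularWardShape a W`), with the certificates that the Yang–Mills weights satisfy them
  under the corresponding tree statements (`momentBoundsShape_of_momentBounds` — definitionally the tree's
  `abs_torusMoment_le_of_momentBounds`; `angularWardShape_of_latticeAngularWard` — every sequence with the ranges is a scheme).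

No fact, no sorry; nothing here is a statement about the Yang–Mills measure beyond the two transcription certificates.
-/

set_option autoImplicit false

noncomputable section

open scoped SchwartzMap BigOperators RealInnerProductSpace ContDiff
open MeasureTheory Filter Topology Metric
open Literature.MathematicalPhysics.QuantumFieldTheory Literature.MathematicalPhysics.QuantumLattice
open Literature.MathematicalPhysics.AQFT
open Literature.Probability.LatticeModels (box Site mem_box)
open Summit.QuantumFields.YangMills.Cruxes.OSLegsFromFemtoAndGap.DlrCollarTransfer (MomentBounds)
open Summit.QuantumFields.YangMills.Cruxes.OSLegsAtWeakCouplingC.Sketch (Separated SmallDiam)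
open Summit.QuantumFields.YangMills.Cruxes.OSLegsAtWeakCouplingC.Y2Bridge (LatticeRotWard)
open Summit.QuantumFields.YangMills.Cruxes.OSLegsAtWeakCouplingC.Y2Bridge.King (KingClass)
open Summit.QuantumFields.YangMills.Theorems.OSLegsFromFemtoAndGap (torusMoment mul_norm_le_norm_smul_siteToE
  norm_smul_siteToE_sub_le abs_coord_le_norm_siteToE siteToE_sub)
open Summit.QuantumFields.YangMills.Theorems.NPointIsotropy.Negative (E4)

namespace Summit.QuantumFields.YangMills.Theorems.ROT.Ward

section TestFunction

variable (s : ℝ) (hs : 0 < s)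

/-! ## §1 The rotational derivative of `F_s` -/

/-- `∂_θ ψ = 0` (radial). -/
theorem angDeriv_psiFun (v : E4) : angDeriv psiFun v = 0 :=
  angDeriv_radial eta ((eta.contDiff (n := ⊤)).differentiable (by simp)) v

/-- `∂_θ χ_s = 0` (radial). -/
theorem angDeriv_chiFun (z : E4) : angDeriv (chiFun s hs) z = 0 :=
  angDeriv_radial (chiBump s hs) (((chiBump s hs).contDiff (n := ⊤)).differentiable (by simp)) z

/-- `∂_θ φ_s = χ_s · h`. -/
theorem angDeriv_phiFun (z : E4) : angDeriv (phiFun s hs) z = chiFun s hs z * hFun z := by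
  have hg : DifferentiableAt ℝ gFun z := (contDiff_gFun.differentiable (by simp)).differentiableAt
  have hc : DifferentiableAt ℝ (chiFun s hs) z :=
    ((contDiff_bump_norm_sq (chiBump s hs)).differentiable (by simp)).differentiableAt
  show angDeriv (fun z => gFun z * chiFun s hs z) z = _
  rw [angDeriv_mul _ _ z hg hc, angDeriv_chiFun, angDeriv_gFun]
  ring

/-- **The rotational derivative of `f_s`**: `df_s(w)·Y(w) = ψ(w₁) · χ_s(w₀−w₁) · h(w₀−w₁)` (product and chain rules; the radial
factors contribute nothing). -/
theorem fderiv_fFun_rotField (w : Fin 2 → E4) :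
    fderiv ℝ (fFun s hs) w (fun k => rotVec (w k)) = psiFun (w 1) * (chiFun s hs (w 0 - w 1) * hFun (w 0 - w 1)) := by
  have hP : HasFDerivAt (fun w : Fin 2 → E4 => w 0 - w 1)
      ((ContinuousLinearMap.proj (0 : Fin 2) - ContinuousLinearMap.proj (1 : Fin 2) : (Fin 2 → E4) →L[ℝ] E4)) w :=
    (hasFDerivAt_apply (𝕜 := ℝ) (0 : Fin 2) w).fun_sub (hasFDerivAt_apply (𝕜 := ℝ) (1 : Fin 2) w)
  have hQ : HasFDerivAt (fun w : Fin 2 → E4 => w 1) (ContinuousLinearMap.proj (1 : Fin 2) : (Fin 2 → E4) →L[ℝ] E4) w :=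
    hasFDerivAt_apply (𝕜 := ℝ) (1 : Fin 2) w
  have hφ : DifferentiableAt ℝ (phiFun s hs) (w 0 - w 1) :=
    ((contDiff_phiFun s hs).differentiable (by simp)).differentiableAt
  have hψ : DifferentiableAt ℝ psiFun (w 1) := (contDiff_psiFun.differentiable (by simp)).differentiableAt
  have hA := hφ.hasFDerivAt.comp w hP
  have hB := hψ.hasFDerivAt.comp w hQ
  have key := hA.mul hB
  have e : fFun s hs = (phiFun s hs ∘ fun w : Fin 2 → E4 => w 0 - w 1) * (psiFun ∘ fun w : Fin 2 → E4 => w 1) := rfl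
  rw [e, key.fderiv]
  have h1 : fderiv ℝ psiFun (w 1) (rotVec (w 1)) = 0 := angDeriv_psiFun (w 1)
  have h2 : fderiv ℝ (phiFun s hs) (w 0 - w 1) (rotVec (w 0 - w 1)) = chiFun s hs (w 0 - w 1) * hFun (w 0 - w 1) :=
    angDeriv_phiFun s hs _
  simp only [add_apply, smul_apply, ContinuousLinearMap.comp_apply,
    FunLike.coe_sub, Pi.sub_apply, ContinuousLinearMap.proj_apply, smul_eq_mul, Function.comp_apply]
  rw [← rotVec_sub, h1, h2]
  ring

/-- The rotational derivative of the complexified `F_s`, pointwise. -/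
theorem fderiv_FTest_rotField (hs1 : s ≤ 1) (w : Fin 2 → E4) :
    fderiv ℝ (FTest s hs hs1 : (Fin 2 → E4) → ℂ) w (fun k => rotVec (w k)) =
      ((psiFun (w 1) * (chiFun s hs (w 0 - w 1) * hFun (w 0 - w 1)) : ℝ) : ℂ) := by
  have hf : HasFDerivAt (fFun s hs) (fderiv ℝ (fFun s hs) w) w :=
    (((contDiff_fFun s hs).differentiable (by simp)).differentiableAt).hasFDerivAt
  have h := (Complex.ofRealCLM.hasFDerivAt.comp w hf).fderiv
  have e : (FTest s hs hs1 : (Fin 2 → E4) → ℂ) = (Complex.ofRealCLM : ℝ → ℂ) ∘ fFun s hs := rfl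
  rw [e, h, ContinuousLinearMap.comp_apply, fderiv_fFun_rotField]
  rfl

end TestFunction

/-! ## §2 The limit integrand -/

section Integrand

variable (s : ℝ) (hs : 0 < s)

/-- The limit integrand `Φ_s(w) = h(z) ψ(w₁) χ_s(z) h(z)`, `z = w₀ − w₁` (a non-negative continuous bump, positive somewhere). -/
def PhiFun (w : Fin 2 → E4) : ℝ :=
  hFun (w 0 - w 1) * (psiFun (w 1) * (chiFun s hs (w 0 - w 1) * hFun (w 0 - w 1)))

/-- `Φ_s` is continuous. -/
theorem continuous_PhiFun : Continuous (PhiFun s hs) := by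
  have hz : Continuous fun w : Fin 2 → E4 => w 0 - w 1 := (continuous_apply 0).sub (continuous_apply 1)
  unfold PhiFun
  exact (continuous_hFun.comp hz).mul ((contDiff_psiFun.continuous.comp (continuous_apply 1)).mul
    (((contDiff_bump_norm_sq (chiBump s hs)).continuous.comp hz).mul (continuous_hFun.comp hz)))

/-- `Φ_s` vanishes outside the ball of radius `4` (`s ≤ 1`). -/
theorem PhiFun_eq_zero_of_norm (hs1 : s ≤ 1) {w : Fin 2 → E4} (hw : 4 < ‖w‖) : PhiFun s hs w = 0 := by
  have h := fFun_eq_zero_of_norm (hs := hs) hs1 hw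
  unfold fFun phiFun at h
  unfold PhiFun chiFun
  rcases mul_eq_zero.1 h with h1 | h1
  · rcases mul_eq_zero.1 h1 with h2 | h2
    · -- `g(z) = 0`: then `η(‖z‖²) z⁰ = 0`; but we need `χ`/`ψ`/`h` — use instead the support characterisation
      by_contra hne
      have hψ : psiFun (w 1) ≠ 0 := by
        intro h0; apply hne; simp [h0]
      have hχ : chiFun s hs (w 0 - w 1) ≠ 0 := by
        intro h0; apply hne; unfold chiFun at h0; simp [h0]
      obtain ⟨-, hz⟩ := chiFun_ne_zero hχ
      have hv := psiFun_ne_zero hψ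
      have h3 : ‖w 0 - w 1‖ < 2 := by nlinarith [norm_nonneg (w 0 - w 1)]
      have h4 : ‖w 1‖ < 2 := by nlinarith [norm_nonneg (w 1)]
      have h5 : ‖w 0‖ < 4 := by
        calc ‖w 0‖ = ‖(w 0 - w 1) + w 1‖ := by rw [sub_add_cancel]
          _ ≤ ‖w 0 - w 1‖ + ‖w 1‖ := norm_add_le _ _
          _ < 4 := by linarith
      have h6 : ‖w‖ ≤ 4 := by
        refine (pi_norm_le_iff_of_nonneg (by norm_num)).2 fun i => ?_
        fin_cases i
        · exact h5.le
        · exact (h4.trans (by norm_num)).le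
      linarith
    · simp [chiFun] at h2 ⊢
      simp [h2]
  · simp [h1]

/-- `Φ_s` has compact support. -/
theorem hasCompactSupport_PhiFun (hs1 : s ≤ 1) : HasCompactSupport (PhiFun s hs) := by
  refine HasCompactSupport.intro (isCompact_closedBall (0 : Fin 2 → E4) 4) fun w hw => ?_
  rw [mem_closedBall, dist_zero_right, not_le] at hw
  exact PhiFun_eq_zero_of_norm s hs hs1 hw

/-- `Φ_s ≥ 0` (it is `ψ χ_s h²`). -/
theorem PhiFun_nonneg (w : Fin 2 → E4) : 0 ≤ PhiFun s hs w := by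
  unfold PhiFun
  have h1 : 0 ≤ psiFun (w 1) := eta.nonneg
  have h2 : 0 ≤ chiFun s hs (w 0 - w 1) := (chiBump s hs).nonneg
  have : PhiFun s hs w = psiFun (w 1) * chiFun s hs (w 0 - w 1) * hFun (w 0 - w 1) ^ 2 := by unfold PhiFun; ring
  nlinarith [sq_nonneg (hFun (w 0 - w 1)), mul_nonneg h1 h2]

/-- `Φ_s > 0` at the point `(s e₁, 0)`. -/
theorem PhiFun_pos (hs1 : s ≤ 1) : 0 < PhiFun s hs (fun i => if i = 0 then EuclideanSpace.single 1 s else 0) := by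
  have hz : (fun i : Fin 2 => if i = 0 then (EuclideanSpace.single 1 s : E4) else 0) 0 -
      (fun i : Fin 2 => if i = 0 then (EuclideanSpace.single 1 s : E4) else 0) 1 = EuclideanSpace.single 1 s := by
    simp
  have hnorm : ‖(EuclideanSpace.single 1 s : E4)‖ = s := by
    rw [PiLp.norm_single, Real.norm_eq_abs, abs_of_pos hs]
  have hh : hFun (EuclideanSpace.single 1 s) = -s := by
    unfold hFun
    rw [hnorm, ContDiffBump.one_of_mem_closedBall]
    · simp
    · simp only [eta, mem_closedBall, dist_zero_right, Real.norm_eq_abs]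
      rw [abs_of_nonneg (by positivity)]
      nlinarith
  have hχ : chiFun s hs (EuclideanSpace.single 1 s) = 1 := chiFun_eq_one hnorm
  unfold PhiFun
  rw [hz, hh, hχ]
  simp only [Fin.one_eq_zero_iff, OfNat.ofNat_ne_one, if_false, psiFun_zero]
  nlinarith

/-- `∫ Φ_s > 0`. -/
theorem integral_PhiFun_pos (hs1 : s ≤ 1) : 0 < ∫ w, PhiFun s hs w :=
  (continuous_PhiFun s hs).integral_pos_of_hasCompactSupport_nonneg_nonzero (hasCompactSupport_PhiFun s hs hs1)
    (PhiFun_nonneg s hs) (PhiFun_pos s hs hs1).ne'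

end Integrand

/-! ## §3 The shape predicates: the TEXTS of `MomentBounds` / `LatticeAngularWard` over an abstract weight family -/

/-- **MomentBounds-SHAPE** — the text of the hyperscaling binder `MomentBounds G r a` (`(C/R⁴)ⁿ` bounds at torus-separated
multi-sites, `1 ≤ R`, `R a(β) ≤ ℓ₄`, `4R + 8 ≤ L`) with the centred torus moment of `tr F²` replaced by an abstract weight family
`W β L n x`.  `MomentBounds G r a` is literally `MomentBoundsShape a (W_YM r)` (`momentBoundsShape_of_momentBounds`). -/
def MomentBoundsShape (a : ℝ → ℝ) (W : ℝ → ℕ → (n : ℕ) → (Fin n → Site 4) → ℝ) : Prop :=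
  ∃ (C β₄ ℓ₄ : ℝ), 0 < ℓ₄ ∧ 0 ≤ C ∧ ∀ β : ℝ, β₄ ≤ β → ∀ (L n : ℕ) (x : Fin n → Site 4) (R : ℕ),
    1 ≤ R → (R : ℝ) * a β ≤ ℓ₄ → 4 * R + 8 ≤ L →
    (∀ i j : Fin n, i ≠ j → ∃ k : Fin 4,
      (2 * (R : ℤ) + 4) ≤ |((((x i k - x j k : ℤ) : ZMod (2 * L + 1))).valMinAbs : ℤ)|) →
    |W β L n x| ≤ (C / (R : ℝ) ^ 4) ^ n

/-- **AngularWard-SHAPE** — the text of `LatticeAngularWard G r a` (along every sequence `(β_k, L_k)` with `β_k → ∞` and the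
soft-bundle torus ranges in units `a`; a germ radius; the germ class; the angular insertion `→ 0`) with the centred torus moment
replaced by an abstract weight family.  `LatticeAngularWard G r a` implies `AngularWardShape a (W_YM r)`
(`angularWardShape_of_latticeAngularWard`). -/
def AngularWardShape (a : ℝ → ℝ) (W : ℝ → ℕ → (n : ℕ) → (Fin n → Site 4) → ℝ) : Prop :=
  ∀ (βs : ℕ → ℝ) (Ls : ℕ → ℕ), Tendsto βs atTop atTop →
    (∀ k, 0 ≤ βs k ∧ a (βs k) ≤ 1 / 24 ∧ 14 ≤ Ls k ∧ (a (βs k))⁻¹ * (a (βs k))⁻¹ ≤ Ls k) →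
      ∃ r₀ : ℝ, 0 < r₀ ∧ ∀ (n : ℕ), 2 ≤ n → ∀ F : 𝓢((Fin n → E4), ℂ), IsOffDiagonal F →
        HasCompactSupport (F : (Fin n → E4) → ℂ) →
        (∃ δ : ℝ, 0 < δ ∧ tsupport (F : (Fin n → E4) → ℂ) ⊆ Separated n δ) →
        tsupport (F : (Fin n → E4) → ℂ) ⊆ SmallDiam n r₀ →
        Tendsto (fun k => angularSum (W (βs k) (Ls k) n) (Ls k) (a (βs k)) F) atTop (𝓝 0)

section Sanity

variable {G : Type} [Group G] [TopologicalSpace G] [IsTopologicalGroup G] [CompactSpace G]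
  [MeasurableSpace G] [BorelSpace G]

/-- `MomentBounds G r a` IS the shape statement for the Yang–Mills weights. -/
theorem momentBoundsShape_of_momentBounds (r : LatticeRep G) {a : ℝ → ℝ} (h : MomentBounds G r a) :
    MomentBoundsShape a (fun β L _ x => torusMoment r.ρ β L r.curvature.F (wilsonTorusMean r.ρ β L r.curvature.F) x) :=
  Summit.QuantumFields.YangMills.Theorems.OSLegsFromFemtoAndGap.abs_torusMoment_le_of_momentBounds r h

/-- `LatticeAngularWard G r a` implies the shape statement for the Yang–Mills weights (every sequence `(β_k, L_k)` with the
ranges is a scheme in units `a`). -/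
theorem angularWardShape_of_latticeAngularWard (r : LatticeRep G) {a : ℝ → ℝ} (hpos : ∀ β, 0 < a β)
    (ha0 : Tendsto a atTop (𝓝 0)) (h : LatticeAngularWard G r a) :
    AngularWardShape a (fun β L _ x => torusMoment r.ρ β L r.curvature.F (wilsonTorusMean r.ρ β L r.curvature.F) x) := by
  intro βs Ls hβ hranges
  have h0 : Tendsto (fun k => a (βs k)) atTop (𝓝[>] 0) :=
    tendsto_nhdsWithin_iff.2 ⟨ha0.comp hβ, Eventually.of_forall fun k => hpos _⟩
  have hL : Tendsto (fun k => a (βs k) * (Ls k : ℝ)) atTop atTop := by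
    refine tendsto_atTop_mono (fun k => ?_) (tendsto_inv_nhdsGT_zero.comp h0)
    have ha := hpos (βs k)
    have h1 := (hranges k).2.2.2
    have h2 : a (βs k) * ((a (βs k))⁻¹ * (a (βs k))⁻¹) ≤ a (βs k) * Ls k := mul_le_mul_of_nonneg_left h1 ha.le
    simpa [← mul_assoc, mul_inv_cancel₀ ha.ne'] using h2
  let sch : SpeciesScheme (YMSpecies G) :=
    { a := fun k => a (βs k), a_pos := fun k => hpos _, tendsto_a := ha0.comp hβ, β := βs, L := Ls,
      tendsto_L := hL, c := fun _ _ => 0, m := fun _ _ => 0 }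
  obtain ⟨r₀, hr₀, H⟩ := h sch (fun _ => rfl) hβ hranges
  exact ⟨r₀, hr₀, fun n hn F hFo hFc hFδ hFr => H n hn F hFo hFc hFδ hFr⟩

end Sanity

end Summit.QuantumFields.YangMills.Theorems.ROT.Ward

end
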